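import Literature.NumberTheory.GaloisRepresentations.KummerKeyStep
import Literature.NumberTheory.GaloisRepresentations.ArtinCharacterReciprocityProofs
import Literature.NumberTheory.GaloisRepresentations.LocalPowerClassIndex
import Literature.NumberTheory.QuadraticForms.NormIndexSecondInequalityProofs
import Mathlib.NumberTheory.NumberField.InfinitePlace.TotallyRealComplex
import HarnessLib

/-!
# Chevalley's congruence theorem over a Kummer field, with exact `n`-th powers

Helper file for the crux `HalfIntegralTwistCM` (stmt-Langlands-14036) of the route
`IrreducibilityBySelfDuality`, line `two-primary-chevalley-core`, stub S1a
(`stub_chevalleyKummerField`): for a totally complex number field `F` containing a primitive `n`-th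
root of unity (`n > 0`) there is a rational modulus `a > 0` such that every unit `u` of `𝓞 F` with
`a ∣ u - 1` is the `n`-th power of a unit of `𝓞 F` — Chevalley 1951, Théorème 1, for `E = 𝓞_Fˣ`
when `μ_n ⊆ F` (C. Chevalley, *Deux théorèmes d'arithmétique*, J. Math. Soc. Japan 3 (1951), p. 36).

Proof, on proved ground of the tree.  Choose a finite set `T` of finite places which is admissible
(`𝕀_F = Fˣ · 𝕀_F^T`, `OMeara65.exists_isAdmissible_superset`) and contains the places above `n`,
and put `a := n² · ∏_{v ∈ T} N(𝔭_v)`.  A unit `u` with `a ∣ u - 1` is `1 + n² z` with `z ∈ 𝔭_v`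
for every `v ∈ T`, hence an `n`-th power in `𝒪_v ⊆ F_v` by Hensel's lemma
(`exists_one_add_mul_pow_eq`: `1 + n² z = (1 + n y)ⁿ`), and it is a unit at every finite place; by
the Kummer key step `exists_pow_eq_of_local_pow_of_unit` (Neukirch, *Bonn Lectures* III (7.7),
proved in the tree from its Artin reciprocity law `artinReciprocity_character_holds`) `u = cⁿ` with
`c ∈ F`, and `c` is a unit of `𝓞 F` (integral as a root of `Xⁿ - u`, invertible because `cⁿ` is).
No new definitions; Mathlib + the tree only.
-/

noncomputable section

set_option linter.dupNamespace false -- project-wide option (lakefile weak.linter.dupNamespace); `Summit.Langlands.Langlands` is the mandated namespace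

open scoped NumberField Valued
open NumberField NumberField.InfinitePlace IsDedekindDomain
open Literature.NumberTheory.GaloisRepresentations Literature.NumberTheory.QuadraticForms
  Literature.NumberTheory.QuadraticForms.OMeara65

namespace Summit.Langlands.Langlands.Theorems.HalfIntegralTwistCM

variable {F : Type} [Field F] [NumberField F]

/-- The finite places of a number field whose prime ideal contains a given non-zero integer `x`
form a finite set (they divide the non-zero ideal `(x)`). [folklore] -/
theorem finite_setOf_mem_asIdeal {x : 𝓞 F} (hx : x ≠ 0) :
    {v : HeightOneSpectrum (𝓞 F) | x ∈ v.asIdeal}.Finite := by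
  have h : Ideal.span {x} ≠ 0 := by
    rw [Ne, Ideal.zero_eq_bot, Ideal.span_singleton_eq_bot]
    exact hx
  refine (Ideal.finite_factors h).subset fun v hv ↦ ?_
  exact Ideal.dvd_span_singleton.2 hv

/-- A unit of `𝓞 F` has `v`-adic valuation `1` at every finite place `v` (it lies in no prime
ideal). [folklore] -/
theorem valuation_coe_units_eq_one (v : HeightOneSpectrum (𝓞 F)) (u : (𝓞 F)ˣ) :
    v.valuation F ((u : 𝓞 F) : F) = 1 := by
  rw [RingOfIntegers.coe_eq_algebraMap, HeightOneSpectrum.valuation_eq_one_iff_notMem]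
  exact fun h => v.isPrime.ne_top (Ideal.eq_top_of_isUnit_mem _ h u.isUnit)

/-- **Local step (Hensel's lemma).** If `z ∈ 𝔭_v` then `1 + n² z` is an `n`-th power in `F_v`:
in the Henselian local ring `𝒪_v` one has `1 + n² z = (1 + n y)ⁿ` for some `y ∈ 𝔪_v`
(`exists_one_add_mul_pow_eq`). [folklore] -/
theorem exists_algebraMap_one_add_eq_pow (v : HeightOneSpectrum (𝓞 F)) (n : ℕ) {z : 𝓞 F}
    (hz : z ∈ v.asIdeal) :
    ∃ c : v.adicCompletion F,
      algebraMap F (v.adicCompletion F) (((1 + (n : 𝓞 F) ^ 2 * z : 𝓞 F)) : F) = c ^ n := by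
  set w : v.adicCompletionIntegers F := algebraMap (𝓞 F) (v.adicCompletionIntegers F) z with hw
  have hwval : (w : v.adicCompletion F) = algebraMap F (v.adicCompletion F) ((z : 𝓞 F) : F) := by
    rw [hw, HeightOneSpectrum.algebraMap_adicCompletionIntegers_apply,
      algebraMap_adicCompletion_apply]
  have hwm : w ∈ IsLocalRing.maximalIdeal (v.adicCompletionIntegers F) := by
    rw [IsLocalRing.mem_maximalIdeal, mem_nonunits_iff,
      HeightOneSpectrum.adicCompletionIntegers.isUnit_iff_valued_eq_one]
    have hlt : Valued.v (w : v.adicCompletion F) < 1 := by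
      rw [hwval, valued_algebraMap_adicCompletion]
      exact (HeightOneSpectrum.valuation_lt_one_iff_mem v z).2 hz
    exact hlt.ne
  obtain ⟨y, -, hy⟩ := exists_one_add_mul_pow_eq (R := v.adicCompletionIntegers F) n hwm
  refine ⟨((1 + (n : v.adicCompletionIntegers F) * y : v.adicCompletionIntegers F) :
    v.adicCompletion F), ?_⟩
  have hlhs : algebraMap F (v.adicCompletion F) (((1 + (n : 𝓞 F) ^ 2 * z : 𝓞 F)) : F) =
      1 + (n : v.adicCompletion F) ^ 2 * (w : v.adicCompletion F) := by
    rw [hwval]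
    show algebraMap F (v.adicCompletion F) (algebraMap (𝓞 F) F (1 + (n : 𝓞 F) ^ 2 * z)) = _
    simp only [map_add, map_one, map_mul, map_pow, map_natCast]
  rw [hlhs, ← SubmonoidClass.coe_pow, hy]
  push_cast
  rfl

/-- **Chevalley's congruence theorem over a Kummer field, exact `n`-th powers** (stub S1a of the
line `two-primary-chevalley-core`).  For a totally complex number field `F` containing a primitive
`n`-th root of unity (`n > 0`) there is `a > 0` in `ℕ` such that every unit `u` of `𝓞 F` with
`a ∣ u - 1` is the `n`-th power of a unit of `𝓞 F`.  With `T ⊇ {v ∣ n}` admissible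
(`exists_isAdmissible_superset`) take `a := n² · ∏_{v ∈ T} N(𝔭_v)`; then `u = 1 + n² z` with
`z ∈ 𝔭_v` (`v ∈ T`) is a local `n`-th power at `T` (Hensel, `exists_algebraMap_one_add_eq_pow`)
and a unit everywhere, hence a global `n`-th power by the Kummer key step
`exists_pow_eq_of_local_pow_of_unit artinReciprocity_character_holds` (Neukirch III (7.7)); an
`n`-th root of a unit is a unit.  This is Chevalley 1951, Théorème 1, for `E = 𝓞_Fˣ` in the case
`μ_n ⊆ F`. [cite: ChevalleyDeuxTheoremes1951, Thm 1 (p. 36), case E = unit group, μ_n ⊆ K] -/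
theorem stub_chevalleyKummerField :
    ∀ (F : Type) [Field F] [NumberField F] [IsTotallyComplex F] (n : ℕ), 0 < n →
      ∀ ζ : F, IsPrimitiveRoot ζ n →
        ∃ a : ℕ, 0 < a ∧ ∀ u : (𝓞 F)ˣ, (a : 𝓞 F) ∣ (u : 𝓞 F) - 1 → ∃ w : (𝓞 F)ˣ, u = w ^ n := by
  intro F _ _ _ n hn ζ hζ
  classical
  -- a finite admissible set of places containing the places above `n`
  have hn0 : ((n : ℕ) : 𝓞 F) ≠ 0 := by exact_mod_cast hn.ne'
  obtain ⟨T₀, hT₀⟩ := exists_isAdmissible_superset (K := F)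
  set T : Finset (HeightOneSpectrum (𝓞 F)) := T₀ ∪ (finite_setOf_mem_asIdeal hn0).toFinset
    with hT
  have hTadm : IsAdmissible F T := hT₀ T Finset.subset_union_left
  have hTn : ∀ v : HeightOneSpectrum (𝓞 F), ((n : ℕ) : 𝓞 F) ∈ v.asIdeal → v ∈ T := fun v hv =>
    Finset.mem_union_right _ ((Set.Finite.mem_toFinset _).2 hv)
  -- the modulus `a = n² · A`, `A = ∏_{v ∈ T} N(𝔭_v)`
  set A : ℕ := ∏ v ∈ T, Ideal.absNorm v.asIdeal with hA
  have hApos : 0 < A := by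
    refine Finset.prod_pos fun v _ => Nat.pos_of_ne_zero ?_
    rw [Ne, Ideal.absNorm_eq_zero_iff]
    exact v.ne_bot
  have hAmem : ∀ v ∈ T, (A : 𝓞 F) ∈ v.asIdeal := by
    intro v hv
    rw [hA, ← Finset.mul_prod_erase T (fun w => Ideal.absNorm w.asIdeal) hv, Nat.cast_mul]
    exact Ideal.mul_mem_right _ _ (Ideal.absNorm_mem v.asIdeal)
  refine ⟨n ^ 2 * A, Nat.mul_pos (pow_pos hn 2) hApos, fun u hu => ?_⟩
  -- `u = 1 + n² z` with `z ∈ 𝔭_v` for all `v ∈ T`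
  obtain ⟨y, hy⟩ := hu
  set z : 𝓞 F := (A : 𝓞 F) * y with hz
  have huz : (u : 𝓞 F) = 1 + (n : 𝓞 F) ^ 2 * z := by
    rw [hz, ← mul_assoc, ← Nat.cast_pow, ← Nat.cast_mul, ← hy]
    ring
  have hzmem : ∀ v ∈ T, z ∈ v.asIdeal := fun v hv => Ideal.mul_mem_right _ _ (hAmem v hv)
  -- the Kummer key step: `u` is a global `n`-th power
  have hb0 : ((u : 𝓞 F) : F) ≠ 0 := RingOfIntegers.coe_ne_zero_iff.mpr u.ne_zero
  have hcomplex : ∀ w : InfinitePlace F, w.IsComplex := IsTotallyComplex.isComplex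
  obtain ⟨c, hc⟩ := exists_pow_eq_of_local_pow_of_unit artinReciprocity_character_holds hn hζ
    hcomplex hTadm hTn hb0 (fun v _ => valuation_coe_units_eq_one v u)
    (fun v hv => by rw [huz]; exact exists_algebraMap_one_add_eq_pow v n (hzmem v hv))
  -- an `n`-th root of a unit is a unit
  have hcint : IsIntegral ℤ c := by
    refine IsIntegral.of_pow hn ?_
    rw [← hc]
    exact RingOfIntegers.isIntegral_coe (u : 𝓞 F)
  set c' : 𝓞 F := ⟨c, hcint⟩ with hc'
  have hc'n : (u : 𝓞 F) = c' ^ n := by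
    apply RingOfIntegers.coe_injective
    rw [map_pow]
    exact hc
  have hc'u : IsUnit c' := (isUnit_pow_iff hn.ne').mp (hc'n ▸ u.isUnit)
  refine ⟨hc'u.unit, Units.ext ?_⟩
  rw [Units.val_pow_eq_pow_val, IsUnit.unit_spec, ← hc'n]

end Summit.Langlands.Langlands.Theorems.HalfIntegralTwistCM

end
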